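import Mathlib
import Literature.Computability.Complexity.CNF
import Summits.PneNP.PneNP.Theorems.OverlapGapAlgebraSolvableImpliesStableSectionBoost
import Summits.PneNP.PneNP.Theorems.OverlapGapAlgebraSolvableImpliesStableSectionSmoothSection

/-!
# Route OverlapGapAlgebra, crux `SolvableImpliesStableSection` (stmt-PneNP-2463), line `Sketch`:
# the crux restricted to `η ≥ 1` is a THEOREM

`solvableImpliesStableSection_of_eta_ge_one`: for every `k ≥ 1`, `α > 0`, `ν > 0` and `η ≥ 1`, the
implication of `SolvableImpliesStableSection` holds — with the hypothesis even weakened to "SOME map (no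
complexity bound) solves with probability `≥ ε` infinitely often". Proof: solved ⇒ satisfiable; Boost
(`boost_typically_valid`: Efron–Stein + Chebyshev on MAX-SAT) makes the arg-max-sat map typically `ν`-valid
(`(k m)#Gᶜ ≤ (2k/ν²)#instances`); Hamming moves never exceed `n ≤ η n`; the engine in the crux's language
(`concl_of_smoothSection`) gives the path event with probability `≥ e^{-cn}`. With `…ConstSection.lean`
(`ν > 2^{-k}`) and `…UnsatRegime.lean` (`α ≥ 2^k`), the contentful regime of the crux is exactly
`η < 1`, `ν ≤ 2^{-k}`, `α < 2^k` (crux notes B2, fully formalised).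
-/

set_option linter.dupNamespace false -- `Summit.PneNP.PneNP.…`: summit = sub-problem (D-0017)

namespace Summit.PneNP.PneNP.Cruxes.SolvableImpliesStableSection.Sketch

open Finset
open scoped Classical

/-- **The crux restricted to `η ≥ 1` holds** (for every `k ≥ 1`, `α > 0`, `ν > 0`): if some map (not even
required to be polynomial-time) solves `F_k(n, ⌊αn⌋)` with probability `≥ ε` for infinitely many `n`, then for
every `c > 0`, infinitely often, some map is `ν`-valid at every splice point of the Bresler–Huang path and
(trivially, as `η n ≥ n`) `ηn`-stable, on `≥ e^{-cn}` of the path tuples. Proof: solved ⇒ satisfiable, so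
`Pr[sat] ≥ ε`; `boost_typically_valid` makes the arg-max-sat map typically `ν`-valid with `(k m)#Gᶜ ≤ (2k/ν²)#Inst`
once `m ≥ 2/(εν²)`; its jumps never exceed `n ≤ η n`; `concl_of_smoothSection`. So the contentful regime of the
crux is `η < 1` (and `ν ≤ 2^{-k}`, `α < 2^k` by the other calibrations). -/
theorem solvableImpliesStableSection_of_eta_ge_one (k : ℕ) (hk : 1 ≤ k) (α η ν : ℝ) (hα : 0 < α)
    (hη : 1 ≤ η) (hν : 0 < ν)
    (hsolv : ∃ f : List Bool → List Bool, ∃ ε : ℝ, 0 < ε ∧ ∃ᶠ n : ℕ in Filter.atTop, ∀ m : ℕ, m = ⌊α * n⌋₊ → ε ≤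
        ((Finset.univ.filter fun Φ : Fin m → Fin k → Fin n × Bool => ∀ i, ∃ j,
          (f (Literature.Computability.Complexity.encodingCNF.encode (List.ofFn fun a =>
            List.ofFn fun b => (((Φ a b).1 : ℕ), (Φ a b).2)))).getD (Φ i j).1 false =
              (Φ i j).2).card : ℝ) / Fintype.card (Fin m → Fin k → Fin n × Bool))
    (c : ℝ) (hc : 0 < c) :
    ∃ᶠ n : ℕ in Filter.atTop, ∀ m : ℕ, m = ⌊α * n⌋₊ →
      ∃ g : (Fin m → Fin k → Fin n × Bool) → (Fin n → Bool),
        Real.exp (-(c * n)) * Fintype.card (Fin (k + 1) → Fin m → Fin k → Fin n × Bool) ≤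
        ((Finset.univ.filter fun Ψ : Fin (k + 1) → Fin m → Fin k → Fin n × Bool =>
          let P : Fin k → ℕ → Fin m → Fin k → Fin n × Bool :=
            fun r q a b => if (a : ℕ) * k + b < q then Ψ r.succ a b else Ψ r.castSucc a b
          (∀ r : Fin k, ∀ q ≤ m * k, ((Finset.univ.filter fun i : Fin m =>
            ∀ j, g (P r q) (P r q i j).1 ≠ (P r q i j).2).card : ℝ) ≤ ν * m) ∧
          ∀ r : Fin k, ∀ q < m * k,
            (hammingDist (g (P r q)) (g (P r (q + 1))) : ℝ) ≤ η * n).card : ℝ) := by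
  obtain ⟨f, ε, hε, hfreq⟩ := hsolv
  set A : ℝ := 2 * k / ν ^ 2 + 1 with hAdef
  have hA : 0 < A := by positivity
  refine concl_of_smoothSection k hk α η ν A hα (by linarith) hA ?_ c hc
  -- eventually `m ≥ 2/(ε ν²)`
  have hm_ev : ∀ᶠ n : ℕ in Filter.atTop, 2 / (ε * ν ^ 2) ≤ (⌊α * n⌋₊ : ℝ) := by
    have ht : Filter.Tendsto (fun n : ℕ => (⌊α * n⌋₊ : ℝ)) Filter.atTop Filter.atTop := by
      refine tendsto_natCast_atTop_atTop.comp ?_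
      exact (tendsto_nat_floor_atTop (α := ℝ)).comp
        (Filter.Tendsto.const_mul_atTop hα tendsto_natCast_atTop_atTop)
    exact ht.eventually (Filter.eventually_ge_atTop _)
  refine (hfreq.and_eventually (hm_ev.and (Filter.eventually_ge_atTop 1))).mono ?_
  rintro n ⟨hn, hmn, hn1⟩ m hm
  -- `Pr[sat] ≥ ε` at this `n`
  have hsat : ε * Fintype.card (Fin m → Fin k → Fin n × Bool)
      ≤ ((univ : Finset (Fin m → Fin k → Fin n × Bool)).filter fun Φ =>
          ∃ σ : Fin n → Bool, ∀ i, ∃ j, σ (Φ i j).1 = (Φ i j).2).card := by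
    have h := hn m hm
    haveI : Nonempty (Fin n × Bool) := ⟨(⟨0, hn1⟩, false)⟩
    have hN : (0 : ℝ) < Fintype.card (Fin m → Fin k → Fin n × Bool) := by exact_mod_cast Fintype.card_pos
    rw [le_div_iff₀ hN] at h
    refine h.trans ?_
    exact_mod_cast Finset.card_le_card fun Φ hΦ => by
      simp only [Finset.mem_filter, Finset.mem_univ, true_and] at hΦ ⊢
      exact ⟨fun v => (f (Literature.Computability.Complexity.encodingCNF.encode (List.ofFn fun a =>
        List.ofFn fun b => (((Φ a b).1 : ℕ), (Φ a b).2)))).getD (v : ℕ) false, hΦ⟩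
  have hmn' : 2 / (ε * ν ^ 2) ≤ (m : ℝ) := by rw [hm]; exact hmn
  obtain ⟨g, hg⟩ := boost_typically_valid k m n ν ε hν hε hmn' hsat
  refine ⟨g, (univ : Finset (Fin m → Fin k → Fin n × Bool)).filter fun Φ =>
    (((univ : Finset (Fin m)).filter fun i => ∀ j, g Φ (Φ i j).1 ≠ (Φ i j).2).card : ℝ) ≤ ν * m, ?_, ?_, ?_⟩
  · intro Φ hΦ
    exact (Finset.mem_filter.1 hΦ).2
  · rw [Finset.compl_filter]
    refine hg.trans ?_
    have hN0 : (0 : ℝ) ≤ Fintype.card (Fin m → Fin k → Fin n × Bool) := Nat.cast_nonneg _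
    nlinarith [hN0]
  · -- no jump exceeds `n ≤ η n`
    have hzero : (∑ a : Fin m, ∑ b : Fin k,
        (((Finset.univ : Finset ((Fin m → Fin k → Fin n × Bool) × (Fin n × Bool))).filter
          fun p => η * n < hammingDist (g p.1)
            (g (Function.update p.1 a (Function.update (p.1 a) b p.2)))).card : ℝ)) = 0 := by
      refine Finset.sum_eq_zero fun a _ => Finset.sum_eq_zero fun b _ => ?_
      rw [Nat.cast_eq_zero, Finset.card_eq_zero, Finset.filter_eq_empty_iff]
      intro p _
      have hd : (hammingDist (g p.1) (g (Function.update p.1 a (Function.update (p.1 a) b p.2))) : ℝ) ≤ n := by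
        exact_mod_cast (hammingDist_le_card_fintype).trans (by rw [Fintype.card_fin])
      have hn0 : (0 : ℝ) ≤ n := Nat.cast_nonneg n
      exact not_lt.2 (by nlinarith)
    rw [hzero]
    positivity

end Summit.PneNP.PneNP.Cruxes.SolvableImpliesStableSection.Sketch
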